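import Mathlib
import HarnessLib
import Literature.Analysis.FluidPDE.SelfSimilar
import Literature.Analysis.FluidPDE.LocalTypeI
import Literature.Analysis.FluidPDE.TypeIAncientMild
import Literature.Analysis.FluidPDE.OseenMildUniqueness
import Literature.Analysis.FluidPDE.NSBoundedMildAnalytic
import Literature.Analysis.UnboundedOperators.HeatKernel
import Summits.NavierStokesRegularity.NavierStokesRegularity.Theorems.LocalSineTubeDoorProfileAlignedWindowRigidityAncient
import Summits.NavierStokesRegularity.NavierStokesRegularity.Theorems.PoloidalWindowDoorPoloidalWindowRigidityZoomOut
import Summits.NavierStokesRegularity.NavierStokesRegularity.Theorems.PoloidalWindowDoorPoloidalWindowRigidityWindow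
import Summits.NavierStokesRegularity.NavierStokesRegularity.Theorems.PoloidalWindowDoorPoloidalWindowRigidityOneSlice
import Summits.NavierStokesRegularity.NavierStokesRegularity.Theorems.PoloidalWindowDoorPoloidalWindowRigidityPoloidalExtremal
import Summits.NavierStokesRegularity.NavierStokesRegularity.Theorems.PoloidalWindowDoorPoloidalWindowRigiditySymmetryGerms
import Summits.NavierStokesRegularity.NavierStokesRegularity.Theorems.SqueezeCycleExtremalElementExistsExtraction

/-!
# K2 `PoloidalWindowRigidity` (stmt-NavierStokesRegularity-19708) — A SUB-PARABOLIC DIRECTIONAL GRADIENT MAKES THE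
# APEX REGULAR (class-level endgame; line `entire_slices`, rung `stub_expTypeTH`, step (A) of seat ns-es-p1 g2)

Seat ns-es-p1 g2 (prover on the rung `stub_expTypeTH` of `Cruxes/PoloidalWindowRigidity/Lines/entire_slices.lean`;
file `--supports stmt-NavierStokesRegularity-19708 --as helper`).

A profile of the route's Type-I class — Type-I rate `‖v(t,x)‖ ≤ C/√(−t)`, `uncurry v` continuous on the open slab
`(−∞,0) × ℝ³`, unit-viscosity Oseen-mild between negative times, divergence-free slices — whose derivative along ONE
fixed direction `e ≠ 0` obeys the SUB-PARABOLIC bound `‖Dv(t)(x) e‖ ≤ K/√(−t)` on the whole slab (the parabolic size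
of a gradient at a singular apex is `(−t)⁻¹`) is NOT backward-singular at the apex `(0,0)`
(`not_backwardSingular_of_fderiv_apply_bound`).  This is the endgame of the seat's route to `stub_expTypeTH`: horizontal
band-limitation of the slices (exponential type in `x_h`) gives exactly such a bound by Bernstein's inequality (files (B)–(D)).

Proof (KNSS blow-up inside the class, all tools in the tree).  Let `ε` be the lifespan constant of the PROVED local fact
`Literature.Analysis.FluidPDE.lemarieRieusset2016_local_analyticity_holds` (Lemarié-Rieusset 2016 Thm 9.12 / Thm 5.1: a
datum bounded by `M` at time `s` has a bounded Oseen-mild solution on `(s, s + ε/M²)`), and `ε₁ := min 1 (ε/2)`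
(so `ε₁² < ε`).  DICHOTOMY.
* (i) Some slice is small in the scale-invariant norm, `√(−t₁)‖v(t₁,·)‖_∞ ≤ ε₁`: then the local solution from `v(t₁)`
  lives on `(t₁, t₁ + ε(−t₁)/ε₁²) ⊋ (t₁, 0]`, is bounded, and coincides with `v` on `(t₁, 0)` (bounded-mild uniqueness
  `oseenMild_bounded_unique` on every `(t₁, T)`, `T < 0`, where `v` is bounded by Type I; continuous slices a.e. equal
  coincide) — so `v` is bounded on the backward cylinder `Q_{√(−t₁)}(0,0)`: not singular
  (`bounded_of_small_slice`, `not_backwardSingular_of_bounded_near`).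
* (ii) Otherwise pick `x_k` with `√(−t_k)‖v(t_k,x_k)‖ > ε₁` at `t_k = −λ_k²`, `λ_k = 1/(k+1) → 0`, and zoom IN:
  `w_k(s,y) = λ_k v(λ_k² s, x_k + λ_k y)` is in the class with the same constant (tree `…ZoomOut.class_zoom`,
  `…Window.isTypeIAncientMild_of_class`), `‖w_k(−1,0)‖ > ε₁`, and `‖Dw_k(−1)(y) e‖ = λ_k²‖Dv(t_k)(x_k + λ_k y) e‖ ≤ λ_k K → 0`.
  KNSS compactness (tree `Theorems.exists_tendsto_of_isTypeIAncientMild_seq`: fields AND gradients converge pointwise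
  along a subsequence to a class profile `W`) gives `‖W(−1,0)‖ ≥ ε₁ > 0` and `DW(−1)(y) e = 0` for all `y`, i.e. the slice
  `W(−1)` is invariant under the translations along `e`; the tree's one-slice Liouville theorem
  `…OneSlice.eq_zero_of_translate_eq_slice` forces `W ≡ 0` — contradiction.  (Case (ii) is absurd outright.)

* `bounded_of_small_slice` — (i), the bound `‖v‖ ≤ C_LR·M` on `(t₁,0) × ℝ³`;
* `not_backwardSingular_of_bounded_near` — bounded on `(t₁,0) × ℝ³` ⇒ `¬ IsBackwardSingularPoint v 0`;
* `not_backwardSingular_of_fderiv_apply_bound` — the endgame (tree bookkeeping reused: `…Ancient.continuous_slice`,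
  `…SymmetryGerms.translate_eq_of_fderiv_apply_eq_zero`).

WHAT THIS IS NOT: not a claim about Navier–Stokes regularity, not the crux, not the rung — a class-level endgame
(bears_on LADDER-NS N0 via crux K2 = stmt-19708; no poloidality, window or pin is used).  No summit statement is proved here.
-/

noncomputable section

-- the summit and its single sub-problem share the name (CONVENTIONS §1), as in every Theorems file
set_option linter.dupNamespace false

namespace Summit.NavierStokesRegularity.NavierStokesRegularity.Theorems.PoloidalWindowDoorPoloidalWindowRigiditySubparabolicGradient

open Set Function Filter MeasureTheory Metric Topology
open scoped ENNReal
open Literature.Analysis Literature.Analysis.FluidPDE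
open Summit.NavierStokesRegularity.NavierStokesRegularity.Theorems.LocalSineTubeDoorProfileAlignedWindowRigidityAncient
open Summit.NavierStokesRegularity.NavierStokesRegularity.Theorems.PoloidalWindowDoorPoloidalWindowRigidityZoomOut
open Summit.NavierStokesRegularity.NavierStokesRegularity.Theorems.PoloidalWindowDoorPoloidalWindowRigidityWindow
open Summit.NavierStokesRegularity.NavierStokesRegularity.Theorems.PoloidalWindowDoorPoloidalWindowRigidityOneSlice
open Summit.NavierStokesRegularity.NavierStokesRegularity.Theorems.PoloidalWindowDoorPoloidalWindowRigidityPoloidalExtremal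
open Summit.NavierStokesRegularity.NavierStokesRegularity.Theorems.PoloidalWindowDoorPoloidalWindowRigiditySymmetryGerms

variable {C : ℝ} {v : ℝ → EuclideanSpace ℝ (Fin 3) → EuclideanSpace ℝ (Fin 3)}

/-! ### (i) A small slice makes the apex regular -/

/-- **Bounded up to the apex from ONE bounded slice with a long enough lifespan.**  If `‖v(t₁,·)‖ ≤ M` with
`−t₁ ≤ ε/M²` (`ε`, `C_LR` the constants of a local bounded-mild existence statement of the shape of
`lemarieRieusset2016_local_analyticity`), then `‖v(t,x)‖ ≤ C_LR·M` for all `t ∈ (t₁, 0)`, `x ∈ ℝ³`: the local solution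
from the datum `v(t₁)` lives past time `0` and agrees with `v` on every `(t₁, T)`, `T < 0`, by bounded-mild uniqueness. -/
theorem bounded_of_small_slice (hrate : HasTypeITimeDecay C v)
    (hcont : ContinuousOn (uncurry v) (Iio (0 : ℝ) ×ˢ univ))
    (hmild : ∀ s t : ℝ, s < t → t < 0 → ∀ x,
      v t x = UnboundedOperators.heatExtension (v s) (t - s) x - oseenDuhamel 1 s v v t x)
    {ε Cl : ℝ}
    (hLoc : ∀ ⦃ν : ℝ⦄, 0 < ν → ∀ (s : ℝ) ⦃M : ℝ⦄, 0 < M → ∀ ⦃a : EuclideanSpace ℝ (Fin 3) → EuclideanSpace ℝ (Fin 3)⦄,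
      AEStronglyMeasurable a volume → eLpNorm a ∞ volume ≤ ENNReal.ofReal M →
      ∃ w : ℝ → EuclideanSpace ℝ (Fin 3) → EuclideanSpace ℝ (Fin 3),
        AnalyticOnNhd ℝ (uncurry w) (Ioo s (s + ε * ν / M ^ 2) ×ˢ (univ : Set (EuclideanSpace ℝ (Fin 3)))) ∧
        (∀ t ∈ Ioo s (s + ε * ν / M ^ 2), ∀ x,
          w t x = UnboundedOperators.heatExtension a (ν * (t - s)) x - oseenDuhamel ν s w w t x) ∧
        ∀ t ∈ Ioo s (s + ε * ν / M ^ 2), ∀ x, ‖w t x‖ ≤ Cl * M)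
    {t₁ M : ℝ} (ht₁ : t₁ < 0) (hM : 0 < M) (hvM : ∀ x, ‖v t₁ x‖ ≤ M) (hwin : -t₁ ≤ ε / M ^ 2) :
    ∀ t ∈ Ioo t₁ 0, ∀ x, ‖v t x‖ ≤ Cl * M := by
  intro t ht x
  -- the datum `v t₁`: continuous, hence measurable, essentially bounded by `M`
  have hvs : Continuous (v t₁) := continuous_slice hcont ht₁
  have ha : AEStronglyMeasurable (v t₁) volume := hvs.aestronglyMeasurable
  have haM : eLpNorm (v t₁) ∞ volume ≤ ENNReal.ofReal M := by
    rw [eLpNorm_exponent_top]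
    exact eLpNormEssSup_le_of_ae_bound (Eventually.of_forall fun y => hvM y)
  obtain ⟨vl, hvl_an, hvl_eq, hvl_bd⟩ := hLoc one_pos t₁ hM ha haM
  -- the uniqueness window `(t₁, T₂)`, `T₂ = t/2 < 0`, inside the lifespan
  set T₂ : ℝ := t / 2 with hT₂
  have htT₂ : t < T₂ := by rw [hT₂]; linarith [ht.2]
  have hT₂0 : T₂ < 0 := by rw [hT₂]; linarith [ht.2]
  have hT₂w : T₂ ≤ t₁ + ε * 1 / M ^ 2 := by rw [mul_one]; linarith
  have hsubw : Ioo t₁ T₂ ⊆ Ioo t₁ (t₁ + ε * 1 / M ^ 2) := Ioo_subset_Ioo_right hT₂w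
  -- a common bound on the window: Type I for `v`, `C_LR M` for `vl`
  obtain ⟨B, hB⟩ := bdd_of_hasTypeITimeDecay hrate (-T₂) (by linarith)
  set M'' : ℝ := max B (Cl * M) with hM''
  have hCl0 : 0 ≤ Cl * M := by
    have h0 := hvl_bd t ⟨ht.1, htT₂.trans_le hT₂w⟩ x
    exact (norm_nonneg _).trans h0
  have hM''0 : 0 ≤ M'' := hCl0.trans (le_max_right _ _)
  have hsub : Ioo t₁ T₂ ×ˢ (univ : Set (EuclideanSpace ℝ (Fin 3))) ⊆ Iio 0 ×ˢ univ :=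
    prod_mono (fun τ hτ => hτ.2.trans hT₂0) Subset.rfl
  have hum : AEStronglyMeasurable (uncurry v) (volume.restrict (Ioo t₁ T₂ ×ˢ univ)) :=
    (hcont.mono hsub).aestronglyMeasurable (measurableSet_Ioo.prod MeasurableSet.univ)
  have hvm : AEStronglyMeasurable (uncurry vl) (volume.restrict (Ioo t₁ T₂ ×ˢ univ)) :=
    (hvl_an.continuousOn.mono (prod_mono hsubw Subset.rfl)).aestronglyMeasurable
      (measurableSet_Ioo.prod MeasurableSet.univ)
  have huM : ∀ τ ∈ Ioo t₁ T₂, ∀ y, ‖v τ y‖ ≤ M'' := fun τ hτ y =>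
    (hB τ (by simpa using hτ.2) y).trans (le_max_left _ _)
  have hvM' : ∀ τ ∈ Ioo t₁ T₂, ∀ y, ‖vl τ y‖ ≤ M'' := fun τ hτ y =>
    (hvl_bd τ (hsubw hτ) y).trans (le_max_right _ _)
  have hu : ∀ τ ∈ Ioo t₁ T₂, v τ =ᵐ[volume] fun y =>
      UnboundedOperators.heatExtension (v t₁) (τ - t₁) y - oseenDuhamel 1 t₁ v v τ y :=
    fun τ hτ => Eventually.of_forall fun y => hmild t₁ τ hτ.1 (hτ.2.trans hT₂0) y
  have hv : ∀ τ ∈ Ioo t₁ T₂, vl τ =ᵐ[volume] fun y =>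
      UnboundedOperators.heatExtension (v t₁) (τ - t₁) y - oseenDuhamel 1 t₁ vl vl τ y := by
    intro τ hτ
    refine Eventually.of_forall fun y => ?_
    have e := hvl_eq τ (hsubw hτ) y
    rwa [one_mul] at e
  have hae : ∀ τ ∈ Ioo t₁ T₂, v τ =ᵐ[volume] vl τ :=
    oseenMild_bounded_unique (U := fun τ y => UnboundedOperators.heatExtension (v t₁) (τ - t₁) y)
      one_pos hM''0 hum hvm huM hvM' hu hv
  -- a.e. equal continuous slices coincide
  have hvlc : ∀ τ ∈ Ioo t₁ T₂, Continuous (vl τ) := by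
    intro τ hτ
    have h : Continuous (uncurry vl ∘ fun y : EuclideanSpace ℝ (Fin 3) => (τ, y)) :=
      hvl_an.continuousOn.comp_continuous (by fun_prop) fun y => mk_mem_prod (hsubw hτ) (mem_univ y)
    exact h
  have heq : v t = vl t :=
    ((continuous_slice hcont ht.2).ae_eq_iff_eq volume (hvlc t ⟨ht.1, htT₂⟩)).1 (hae t ⟨ht.1, htT₂⟩)
  rw [heq]
  exact hvl_bd t (hsubw ⟨ht.1, htT₂⟩) x

/-- **Bounded on `(t₁, 0) × ℝ³` ⇒ not backward-singular at the apex**: the backward cylinder `Q_r(0,0)` with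
`r = √(−t₁)` lies in `(t₁, 0) × ℝ³`. -/
theorem not_backwardSingular_of_bounded_near {t₁ B : ℝ} (ht₁ : t₁ < 0)
    (hB : ∀ t ∈ Ioo t₁ 0, ∀ x, ‖v t x‖ ≤ B) : ¬ IsBackwardSingularPoint v 0 := by
  intro hsing
  set r : ℝ := Real.sqrt (-t₁) with hr
  have hr0 : 0 < r := Real.sqrt_pos.2 (by linarith)
  have hr2 : r ^ 2 = -t₁ := Real.sq_sqrt (by linarith)
  have h1 := hsing r hr0
  have hmeas : MeasurableSet (parabolicCylinder r (0 : ℝ × EuclideanSpace ℝ (Fin 3))) :=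
    show MeasurableSet (Ioo _ _ ×ˢ ball _ _) from measurableSet_Ioo.prod measurableSet_ball
  have hle : eLpNorm (uncurry v) ∞ (volume.restrict (parabolicCylinder r (0 : ℝ × EuclideanSpace ℝ (Fin 3)))) ≤
      ENNReal.ofReal B := by
    rw [eLpNorm_exponent_top]
    refine eLpNormEssSup_le_of_ae_bound ((ae_restrict_iff' hmeas).2 (Eventually.of_forall ?_))
    intro z hz
    have hz' : z ∈ Ioo ((0 : ℝ × EuclideanSpace ℝ (Fin 3)).1 - r ^ 2) (0 : ℝ × EuclideanSpace ℝ (Fin 3)).1 ×ˢ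
        ball (0 : ℝ × EuclideanSpace ℝ (Fin 3)).2 r := hz
    obtain ⟨hzt, -⟩ := mem_prod.1 hz'
    have hzt' : z.1 ∈ Ioo t₁ 0 := ⟨by simpa [hr2] using hzt.1, by simpa using hzt.2⟩
    exact hB z.1 hzt' z.2
  exact absurd h1 (hle.trans_lt ENNReal.ofReal_lt_top).ne

/-! ### The endgame -/

/-- **A SUB-PARABOLIC DIRECTIONAL GRADIENT MAKES THE APEX REGULAR.**  A profile of the route's Type-I class
(Type-I rate, continuity on the open slab, unit-viscosity Oseen-mild identity, divergence-free slices) with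
`‖Dv(t)(x) e‖ ≤ K/√(−t)` for all `t < 0`, `x ∈ ℝ³` along one fixed direction `e ≠ 0` is not backward-singular at
`(0,0)`.  See the module docstring for the proof (small-slice regularity, or zoom-in + KNSS compactness + the one-slice
translation Liouville theorem of the tree). -/
theorem not_backwardSingular_of_fderiv_apply_bound (hrate : HasTypeITimeDecay C v)
    (hcont : ContinuousOn (uncurry v) (Iio (0 : ℝ) ×ˢ univ))
    (hmild : ∀ s t : ℝ, s < t → t < 0 → ∀ x,
      v t x = UnboundedOperators.heatExtension (v s) (t - s) x - oseenDuhamel 1 s v v t x)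
    (hdiv : ∀ t < 0, VectorCalculus.IsDivFree (v t)) {e : EuclideanSpace ℝ (Fin 3)} (he : e ≠ 0) {K : ℝ}
    (hK : ∀ t < 0, ∀ x, ‖fderiv ℝ (v t) x e‖ ≤ K / Real.sqrt (-t)) :
    ¬ IsBackwardSingularPoint v 0 := by
  obtain ⟨ε, hε, Cl, -, hLoc⟩ := lemarieRieusset2016_local_analyticity_holds
  -- `ε₁ > 0` with `ε₁² < ε`
  set ε₁ : ℝ := min 1 (ε / 2) with hε₁
  have hε₁0 : 0 < ε₁ := lt_min one_pos (by linarith)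
  have hε₁1 : ε₁ ≤ 1 := min_le_left _ _
  have hε₁2 : ε₁ ≤ ε / 2 := min_le_right _ _
  have hε₁sq : ε₁ ^ 2 < ε := by nlinarith
  by_cases hsmall : ∃ t₁ < (0 : ℝ), ∀ x, Real.sqrt (-t₁) * ‖v t₁ x‖ ≤ ε₁
  · -- (i) a small slice
    obtain ⟨t₁, ht₁, h⟩ := hsmall
    have hs : 0 < Real.sqrt (-t₁) := Real.sqrt_pos.2 (by linarith)
    set M : ℝ := ε₁ / Real.sqrt (-t₁) with hMdef
    have hM : 0 < M := div_pos hε₁0 hs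
    have hvM : ∀ x, ‖v t₁ x‖ ≤ M := fun x => by
      rw [hMdef, le_div_iff₀ hs, mul_comm]; exact h x
    have hM2 : M ^ 2 = ε₁ ^ 2 / (-t₁) := by
      rw [hMdef, div_pow, Real.sq_sqrt (by linarith)]
    have hwin : -t₁ ≤ ε / M ^ 2 := by
      rw [hM2, le_div_iff₀ (div_pos (pow_pos hε₁0 2) (by linarith))]
      have ht₁0 : -t₁ ≠ 0 := by linarith
      have h1 : -t₁ * (ε₁ ^ 2 / -t₁) = ε₁ ^ 2 := by rw [mul_comm, div_mul_cancel₀ _ ht₁0]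
      rw [h1]; exact hε₁sq.le
    exact not_backwardSingular_of_bounded_near ht₁ (bounded_of_small_slice hrate hcont hmild hLoc ht₁ hM hvM hwin)
  · -- (ii) no small slice: zoom in at near-maximisers — absurd
    exfalso
    push Not at hsmall
    -- scales `λ_k = 1/(k+1)`, times `t_k = -λ_k²`, near-maximisers `x_k`
    set lam : ℕ → ℝ := fun k => 1 / ((k : ℝ) + 1) with hlam
    have hlam0 : ∀ k, 0 < lam k := fun k => by rw [hlam]; positivity
    have hlamto : Tendsto lam atTop (𝓝 0) := tendsto_one_div_add_atTop_nhds_zero_nat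
    have htk : ∀ k, -(lam k) ^ 2 < 0 := fun k => by have := hlam0 k; nlinarith
    choose x hx using fun k => hsmall (-(lam k) ^ 2) (htk k)
    have hsq : ∀ k, Real.sqrt (-(-(lam k) ^ 2)) = lam k := fun k => by
      rw [neg_neg, Real.sqrt_sq (hlam0 k).le]
    -- the zooms `w_k(s, y) = λ_k v(λ_k² s, x_k + λ_k y)` are in the class
    set w : ℕ → ℝ → EuclideanSpace ℝ (Fin 3) → EuclideanSpace ℝ (Fin 3) :=
      fun k s y => lam k • v (lam k ^ 2 * s) (x k + lam k • y) with hw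
    have hwcl : ∀ k, IsTypeIAncientMild C (w k) := by
      intro k
      obtain ⟨h1, h2, h3, h4⟩ := class_zoom hrate hcont hmild hdiv (hlam0 k) (x k)
      exact isTypeIAncientMild_of_class h1 h2 h3 h4
    obtain ⟨φ, hφ, W, hW, hpt, hD, -, -⟩ := Theorems.exists_tendsto_of_isTypeIAncientMild_seq C hwcl
    -- (a) the limit is non-trivial at `(-1, 0)`
    have hwk : ∀ k, ε₁ < ‖w k (-1) 0‖ := by
      intro k
      have e1 : w k (-1) 0 = lam k • v (-(lam k) ^ 2) (x k) := by
        simp only [hw, smul_zero, add_zero, mul_neg, mul_one]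
      rw [e1, norm_smul, Real.norm_of_nonneg (hlam0 k).le]
      have := hx k
      rwa [hsq k] at this
    have hWge : ε₁ ≤ ‖W (-1) 0‖ :=
      ge_of_tendsto ((hpt (-1) (by norm_num) 0).norm) (Eventually.of_forall fun j => (hwk (φ j)).le)
    -- (b) the limit slice `W(-1)` has zero derivative along `e`
    have hDwk : ∀ k y, ‖fderiv ℝ (w k (-1)) y e‖ ≤ lam k * K := by
      intro k y
      have e1 : w k (-1) = nsRescale (lam k) (fun t z => v t (x k + z)) (-1) := by
        funext y; simp only [hw, nsRescale]
      rw [e1, fderiv_nsRescale_slice, fderiv_comp_add_left, smul_apply, norm_smul,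
        Real.norm_of_nonneg (sq_nonneg _)]
      have hb := hK (lam k ^ 2 * (-1)) (by have := hlam0 k; nlinarith) (x k + lam k • y)
      have hs' : Real.sqrt (-(lam k ^ 2 * (-1))) = lam k := by
        rw [show -(lam k ^ 2 * (-1)) = lam k ^ 2 by ring, Real.sqrt_sq (hlam0 k).le]
      rw [hs'] at hb
      calc lam k ^ 2 * ‖fderiv ℝ (v (lam k ^ 2 * (-1))) (x k + lam k • y) e‖
          ≤ lam k ^ 2 * (K / lam k) := mul_le_mul_of_nonneg_left hb (sq_nonneg _)
        _ = lam k * K := by field_simp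
    have hDW : ∀ y, fderiv ℝ (W (-1)) y e = 0 := by
      intro y
      have ht : Tendsto (fun j => fderiv ℝ (w (φ j) (-1)) y e) atTop (𝓝 (fderiv ℝ (W (-1)) y e)) :=
        ((ContinuousLinearMap.apply ℝ (EuclideanSpace ℝ (Fin 3)) e).continuous.tendsto _).comp
          (hD (-1) (by norm_num) y)
      have hn : Tendsto (fun j => ‖fderiv ℝ (w (φ j) (-1)) y e‖) atTop (𝓝 ‖fderiv ℝ (W (-1)) y e‖) := ht.norm
      have hb : Tendsto (fun j => lam (φ j) * K) atTop (𝓝 0) := by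
        simpa using (hlamto.comp hφ.tendsto_atTop).mul_const K
      have hle : ‖fderiv ℝ (W (-1)) y e‖ ≤ 0 :=
        le_of_tendsto_of_tendsto' hn hb fun j => hDwk (φ j) y
      exact norm_le_zero_iff.1 hle
    -- (c) `W(-1)` is invariant under the translations along `e`, hence `W ≡ 0`
    have hWd : Differentiable ℝ (W (-1)) := (hW.contDiff_slice (by norm_num)).differentiable (by simp)
    have htr : ∀ (y : EuclideanSpace ℝ (Fin 3)) (l : ℝ), W (-1) (y + l • e) = W (-1) y :=
      translate_eq_of_fderiv_apply_eq_zero hWd hDW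
    have hW0 := eq_zero_of_translate_eq_slice hW.hasTypeITimeDecay hW.continuousOn_uncurry
      (fun s t hst ht y => hW.mild_eq_heatExtension hst ht y) (fun t ht => hW.isDivFree ht)
      (by norm_num : (-1 : ℝ) < 0) he htr
    have h0 : W (-1) 0 = 0 := hW0 (-1) (by norm_num) 0
    rw [h0, norm_zero] at hWge
    exact absurd hWge (not_le.2 hε₁0)

end Summit.NavierStokesRegularity.NavierStokesRegularity.Theorems.PoloidalWindowDoorPoloidalWindowRigiditySubparabolicGradient

end
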